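import Literature.NumberTheory.DiophantineGeometry.PlaneSectionVanishingProofs
import Literature.NumberTheory.DiophantineGeometry.PlaneSectionBadParameterCountProofs
import Literature.NumberTheory.DiophantineGeometry.BivariateMonicModelProofs
import Literature.NumberTheory.DiophantineGeometry.PlaneCurveZerosTwoSidedProofs
import Literature.RingTheory.MvPolynomial.KaltofenNoetherFormsProofs
import HarnessLib

/-!
# The averaging estimate for an absolutely irreducible hypersurface (Cafure–Matera 2006, §5.1,
(21)–(22) in parametrised form)

Library file (theorems only). Let `K = 𝔽_q`, `f ∈ K[x₀, …, xₘ]` (`m ≥ 1`) absolutely irreducible of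
total degree `δ ≥ 2`, `δ < q`, `N = N(f)` its number of zeros in `K^{m+1}`, and for
`p = (ν, ω, η) ∈ K^{m+1} × Kᵐ × Kᵐ` let `f_p = f(X + ν₀, ωᵢX + ηᵢY + ν_{i+1})` be the plane section and
`N_p` its number of zeros in `K²`. Summing over the parameters with `η ≠ 0`:

* `∑_p N_p = q² qᵐ (qᵐ - 1) N` and `#{p} = q^{m+1} qᵐ (qᵐ - 1)` (`PlaneSectionCountingProofs`), so
  `q^{m+2} (qᵐ - 1) (N - qᵐ) = ∑_p (N_p - q)`;
* `|N_p - q| ≤ W := (δ-1)(δ-2)√q + 1 + δ + 4δ³` if `f_p` is absolutely irreducible (a monic plane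
  model, `BivariateMonicModelProofs`, and Weil's estimate for singular plane curves,
  `PlaneCurveZerosTwoSidedProofs`; `abs_sub_le_of_irreducible_map`), `|N_p - q| ≤ q²` if `f_p = 0`,
  and `|N_p - q| ≤ (δ - 1) q` otherwise (Lemma 2.1 in the plane);
* `#{p : f_p = 0} ≤ δ² q^{3m-1}` (`PlaneSectionVanishingProofs`).

Hence (`mul_abs_sub_le`) **`q^{m+2}(qᵐ - 1) |N - qᵐ| ≤ q^{m+1} qᵐ (qᵐ - 1) W + δ² q^{3m+1} + (δ-1) q B`**
where `B` is the number of parameters whose section is not absolutely irreducible — the parametrised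
form of Cafure–Matera's (21)–(22) before the effective Bertini count `B` (`PlaneSectionBadParameterCountProofs`)
is inserted.

## References

* A. Cafure, G. Matera, Finite Fields Appl. 12 (2006) 155–185, §5.1, (16)–(22). [CafureMatera2006]
-/

noncomputable section

open scoped Classical
open MvPolynomial Literature.RingTheory.MvPolynomial Polynomial.Bivariate

namespace Literature.NumberTheory.DiophantineGeometry

universe u

variable {K : Type u} [Field K] [Fintype K]

/-! ### The estimate for one absolutely irreducible section -/

/-- The point count of the zero polynomial in two variables is `q²`. [folklore] -/
theorem rationalPointCount_zero_two [DecidableEq K] :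
    rationalPointCount (0 : MvPolynomial (Fin 2) K) = Fintype.card K ^ 2 := by
  unfold rationalPointCount
  rw [Finset.filter_true_of_mem (fun x _ ↦ by simp), Finset.card_univ, Fintype.card_fun,
    Fintype.card_fin]

omit [Fintype K] in
/-- A nonzero `g ∈ K[x₀, x₁]` whose image over an extension is irreducible is not constant:
`deg g ≥ 1`. [folklore] -/
theorem totalDegree_pos_of_irreducible_map {L : Type*} [Field L] (ι : K →+* L)
    {g : MvPolynomial (Fin 2) K} (hirr : Irreducible (MvPolynomial.map ι g)) : 0 < g.totalDegree := by
  by_contra h0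
  rw [not_lt, Nat.le_zero, totalDegree_eq_zero_iff_eq_C] at h0
  apply hirr.not_isUnit
  rw [h0, map_C]
  refine (IsUnit.mk0 _ ?_).map C
  intro h
  apply hirr.ne_zero
  rw [h0, map_C, h, C_0]

/-- **Weil's estimate for one absolutely irreducible plane section** (the `ν(L) = 1` case of
Cafure–Matera's Lemma 5.1, with explicit lower-order term). Let `K = 𝔽_q` and
`g ∈ K[x₀, x₁]` have total degree `e` with `e ≤ δ < q`, and suppose the image of `g` in `K̄[x₀, x₁]`
is irreducible. Then `|N(g) - q| ≤ (δ-1)(δ-2)√q + 1 + δ + 4δ³`. Proof: a shear `x₀ ↦ x₀ + c x₁`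
and a normalisation give an absolutely irreducible monic plane model `Φ ∈ K[X][Y]` of degree `e`
with the same number of zeros (`BivariateMonicModelProofs`), to which
`card_zeros_bounds_of_irreducible_map` applies; then `e ≤ δ`. [cite: CafureMatera2006, Lemma 5.1] -/
theorem abs_sub_le_of_irreducible_map [DecidableEq K] {δ : ℕ} {g : MvPolynomial (Fin 2) K}
    (hirr : Irreducible (MvPolynomial.map (algebraMap K (AlgebraicClosure K)) g))
    (hδ : g.totalDegree ≤ δ) (hq : δ < Fintype.card K) :
    |(rationalPointCount g : ℝ) - Fintype.card K| ≤
      ((δ - 1) * (δ - 2) : ℕ) * √(Fintype.card K : ℝ) + 1 + δ + 4 * (δ : ℝ) ^ 3 := by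
  set ι := algebraMap K (AlgebraicClosure K) with hι
  set e := g.totalDegree with he
  have hg0 : g ≠ 0 := fun h ↦ hirr.ne_zero (by rw [h, map_zero])
  have he0 : 0 < e := totalDegree_pos_of_irreducible_map ι hirr
  -- a good shear and the monic model
  obtain ⟨c, hu⟩ := exists_coeff_shear_ne_zero hg0 (by omega)
  set u := coeff (Finsupp.single 1 g.totalDegree)
    (MvPolynomial.aeval (![X 0 + C c * X 1, X 1] : Fin 2 → MvPolynomial (Fin 2) K) g) with hu'
  set Φ : Polynomial (Polynomial K) := (equivMvPolynomial K).symm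
    (C u⁻¹ * MvPolynomial.aeval (![X 0 + C c * X 1, X 1] : Fin 2 → MvPolynomial (Fin 2) K) g) with hΦ
  obtain ⟨hnat, hmon⟩ := natDegree_model_and_monic hu
  have hnat' : Φ.natDegree = e := hnat
  have hmon' : Φ.Monic := hmon
  have hdeg : ∀ i, i < Φ.natDegree → (Φ.coeff i).natDegree + i ≤ Φ.natDegree := by
    intro i hi
    rw [hnat'] at hi ⊢
    exact natDegree_coeff_model_add_le u hi
  have hirrΦ : Irreducible (Φ.map (Polynomial.mapRingHom ι)) := irreducible_map_model ι hu hirr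
  -- the zero count of the model (for any decidability instance on the defining predicate)
  have hcount : ∀ {inst : DecidablePred fun z : K × K ↦ Φ.evalEval z.1 z.2 = 0},
      (@Finset.filter _ (fun z : K × K ↦ Φ.evalEval z.1 z.2 = 0) inst Finset.univ).card =
        rationalPointCount g := by
    intro inst
    convert card_zeros_model hu
  -- Weil's estimate for the model
  obtain ⟨hup, hlow⟩ := AlgFunctionField.card_zeros_bounds_of_irreducible_map hmon' hdeg ι hirrΦ
  rw [hcount, hnat'] at hup hlow
  -- `e ≤ δ`
  have h12 : (((e - 1) * (e - 2) : ℕ) : ℝ) ≤ ((δ - 1) * (δ - 2) : ℕ) := by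
    exact_mod_cast Nat.mul_le_mul (by omega) (by omega)
  have hs : 0 ≤ √(Fintype.card K : ℝ) := Real.sqrt_nonneg _
  have h12s := mul_le_mul_of_nonneg_right h12 hs
  have he3 : (e : ℝ) ^ 3 ≤ (δ : ℝ) ^ 3 := by
    exact_mod_cast Nat.pow_le_pow_left hδ 3
  have heδ : (e : ℝ) ≤ δ := by exact_mod_cast hδ
  rw [abs_le]
  constructor <;> nlinarith

/-! ### The estimate for one parameter -/

section OneParam

variable [DecidableEq K] {m : ℕ}

/-- **The error of one plane section.** For `f` of degree `δ` with `2 ≤ δ < q` and any parameter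
`p = (ν, ω, η)`: `|N(f_p) - q| ≤ W + [f_p = 0] q² + [f_p not abs. irreducible] (δ-1) q` with
`W = (δ-1)(δ-2)√q + 1 + δ + 4δ³`. [cite: CafureMatera2006, §5.1 (proof of Thm. 5.2)] -/
theorem abs_sub_le_planeSection {f : MvPolynomial (Fin (m + 1)) K} {δ : ℕ} (hδ2 : 2 ≤ δ)
    (hdeg : f.totalDegree = δ) (hq : δ < Fintype.card K) (ν : Fin (m + 1) → K) (ω η : Fin m → K) :
    |(rationalPointCount (planeSection f ν ω η) : ℝ) - Fintype.card K| ≤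
      (((δ - 1) * (δ - 2) : ℕ) * √(Fintype.card K : ℝ) + 1 + δ + 4 * (δ : ℝ) ^ 3) +
        (if planeSection f ν ω η = 0 then (Fintype.card K : ℝ) ^ 2 else 0) +
        (if ¬ Irreducible (MvPolynomial.map (algebraMap K (AlgebraicClosure K)) (planeSection f ν ω η))
          then ((δ : ℝ) - 1) * Fintype.card K else 0) := by
  set g := planeSection f ν ω η with hg
  have hW : (0 : ℝ) ≤ ((δ - 1) * (δ - 2) : ℕ) * √(Fintype.card K : ℝ) + 1 + δ + 4 * (δ : ℝ) ^ 3 := by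
    positivity
  have hq0 : (0 : ℝ) ≤ Fintype.card K := Nat.cast_nonneg _
  have hδ2' : (2 : ℝ) ≤ δ := by exact_mod_cast hδ2
  have hq_le : (Fintype.card K : ℝ) ≤ ((δ : ℝ) - 1) * Fintype.card K := by nlinarith
  have hδq : (0 : ℝ) ≤ ((δ : ℝ) - 1) * Fintype.card K := hq0.trans hq_le
  by_cases h0 : g = 0
  · -- the section vanishes: `N = q²`
    rw [if_pos h0, h0, rationalPointCount_zero_two]
    have h2 : (0 : ℝ) ≤ (if ¬ Irreducible (MvPolynomial.map (algebraMap K (AlgebraicClosure K))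
        (0 : MvPolynomial (Fin 2) K)) then ((δ : ℝ) - 1) * Fintype.card K else 0) := by
      split_ifs <;> first | exact le_rfl | exact hδq
    have hq1 : (1 : ℝ) ≤ Fintype.card K := by exact_mod_cast Fintype.card_pos
    have hqq : (Fintype.card K : ℝ) ≤ (Fintype.card K : ℝ) ^ 2 := by nlinarith
    rw [abs_le]
    push_cast at hW ⊢
    constructor <;> linarith
  · rw [if_neg h0, add_zero]
    by_cases hirr : Irreducible (MvPolynomial.map (algebraMap K (AlgebraicClosure K)) g)
    · rw [if_neg (not_not.2 hirr), add_zero]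
      exact abs_sub_le_of_irreducible_map hirr (hdeg ▸ totalDegree_planeSection_le f ν ω η) hq
    · rw [if_pos hirr]
      -- `N ≤ δ q`
      have hle : (rationalPointCount g : ℝ) ≤ δ * Fintype.card K := by
        have := rationalPointCount_planeSection_le (f := f) (ν := ν) (ω := ω) (η := η) h0
        rw [hdeg] at this
        exact_mod_cast this
      have hnn : (0 : ℝ) ≤ rationalPointCount g := Nat.cast_nonneg _
      rw [abs_le]
      constructor <;> nlinarith

end OneParam

/-! ### Summation over the parameters -/

section Sum

variable [DecidableEq K] {m : ℕ}

/-- The parameters `(ν, ω, η)` with `η ≠ 0` form the product `K^{m+1} × Kᵐ × (Kᵐ ∖ {0})`.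
[folklore] -/
theorem filter_ne_zero_eq_product :
    ((Finset.univ : Finset ((Fin (m + 1) → K) × (Fin m → K) × (Fin m → K))).filter
        fun p ↦ p.2.2 ≠ 0) =
      (Finset.univ ×ˢ (Finset.univ ×ˢ (Finset.univ : Finset (Fin m → K)).erase 0)) := by
  ext p
  simp only [Finset.mem_filter, Finset.mem_univ, true_and, Finset.mem_product, Finset.mem_erase,
    ne_eq, and_true]

/-- Sums over the parameters `(ν, ω, η)` with `η ≠ 0`, as iterated sums with `ν` innermost.
[folklore] -/
theorem sum_filter_ne_zero_eq {M : Type*} [AddCommMonoid M]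
    (F : (Fin (m + 1) → K) × (Fin m → K) × (Fin m → K) → M) :
    ∑ p ∈ (Finset.univ : Finset ((Fin (m + 1) → K) × (Fin m → K) × (Fin m → K))).filter
        (fun p ↦ p.2.2 ≠ 0), F p =
      ∑ ω : Fin m → K, ∑ η ∈ (Finset.univ : Finset (Fin m → K)).erase 0,
        ∑ ν : Fin (m + 1) → K, F (ν, ω, η) := by
  rw [filter_ne_zero_eq_product, Finset.sum_product]
  simp_rw [Finset.sum_product]
  rw [Finset.sum_comm]
  refine Finset.sum_congr rfl fun ω _ ↦ ?_
  rw [Finset.sum_comm]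

omit [Field K] [DecidableEq K] in
/-- Counting parameters `(ν, ω, η)` by slicing along `η` (as sums of indicators). [folklore] -/
theorem sum_ite_eq_sum_sum_ite (Q : (Fin (m + 1) → K) → (Fin m → K) → (Fin m → K) → Prop)
    [∀ a b c, Decidable (Q a b c)] :
    (∑ p : (Fin (m + 1) → K) × (Fin m → K) × (Fin m → K), if Q p.1 p.2.1 p.2.2 then 1 else 0) =
      ∑ η : Fin m → K, ∑ νω : (Fin (m + 1) → K) × (Fin m → K),
        if Q νω.1 νω.2 η then 1 else 0 := by
  rw [Fintype.sum_prod_type]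
  simp_rw [Fintype.sum_prod_type]
  -- `∑ ν, ∑ ω, ∑ η, _ = ∑ η, ∑ ν, ∑ ω, _`
  exact (Finset.sum_congr rfl fun ν _ ↦ Finset.sum_comm).trans Finset.sum_comm

/-- **The averaging identity over the parameters with `η ≠ 0`**:
`∑_p N(f_p) = qᵐ (qᵐ - 1) q² N(f)`. [cite: CafureMatera2006, §5.1 eq. (21)] -/
theorem sum_filter_rationalPointCount_planeSection (f : MvPolynomial (Fin (m + 1)) K) :
    ((∑ p ∈ (Finset.univ : Finset ((Fin (m + 1) → K) × (Fin m → K) × (Fin m → K))).filter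
        (fun p ↦ p.2.2 ≠ 0), rationalPointCount (planeSection f p.1 p.2.1 p.2.2) : ℕ) : ℝ) =
      (Fintype.card K : ℝ) ^ m * ((Fintype.card K : ℝ) ^ m - 1) *
        ((Fintype.card K : ℝ) ^ 2 * rationalPointCount f) := by
  rw [sum_filter_ne_zero_eq, sum_sum_rationalPointCount_planeSection]
  have h1 : 1 ≤ Fintype.card K ^ m := Nat.one_le_pow _ _ Fintype.card_pos
  push_cast [Nat.cast_sub h1]
  ring

/-- **The number of parameters with `η ≠ 0`** is `qᵐ (qᵐ - 1) q^{m+1}`.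
[cite: CafureMatera2006, §5.1 eq. (16)] -/
theorem card_filter_ne_zero :
    ((((Finset.univ : Finset ((Fin (m + 1) → K) × (Fin m → K) × (Fin m → K))).filter
        (fun p ↦ p.2.2 ≠ 0)).card : ℕ) : ℝ) =
      (Fintype.card K : ℝ) ^ m * ((Fintype.card K : ℝ) ^ m - 1) * (Fintype.card K : ℝ) ^ (m + 1) := by
  rw [Finset.card_eq_sum_ones, sum_filter_ne_zero_eq]
  simp only [Finset.sum_const, Finset.card_univ, smul_eq_mul, mul_one, Fintype.card_fun,
    Fintype.card_fin, Finset.card_erase_of_mem (Finset.mem_univ _)]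
  have h1 : 1 ≤ Fintype.card K ^ m := Nat.one_le_pow _ _ Fintype.card_pos
  push_cast [Nat.cast_sub h1]
  ring

/-- **The number of parameters whose section vanishes** is at most `δ² q^{3m-1}`, for `f`
irreducible of degree `δ ≥ 2` in `m + 1 ≥ 2` variables. [cite: CafureMatera2006, §5.1 eq. (18)] -/
theorem card_filter_planeSection_eq_zero_le' (hm : 1 ≤ m) {f : MvPolynomial (Fin (m + 1)) K}
    (hirr : Irreducible f) {δ : ℕ} (hδ2 : 2 ≤ δ) (hdeg : f.totalDegree = δ) :
    ((Finset.univ : Finset ((Fin (m + 1) → K) × (Fin m → K) × (Fin m → K))).filter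
        fun p ↦ planeSection f p.1 p.2.1 p.2.2 = 0).card ≤
      δ ^ 2 * Fintype.card K ^ (3 * m - 1) := by
  have hf0 : f ≠ 0 := hirr.ne_zero
  have hsplit : ((Finset.univ : Finset ((Fin (m + 1) → K) × (Fin m → K) × (Fin m → K))).filter
      fun p ↦ planeSection f p.1 p.2.1 p.2.2 = 0).card =
      ∑ η : Fin m → K, ((Finset.univ : Finset ((Fin (m + 1) → K) × (Fin m → K))).filter
        fun νω ↦ planeSection f νω.1 νω.2 η = 0).card := by
    rw [Finset.card_filter]
    simp_rw [Finset.card_filter]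
    exact sum_ite_eq_sum_sum_ite (fun ν ω η ↦ planeSection f ν ω η = 0)
  rw [hsplit]
  have hN : rationalPointCount f ≤ δ * Fintype.card K ^ m := by
    have := rationalPointCount_le_totalDegree_mul hf0
    rwa [hdeg, Nat.add_sub_cancel] at this
  calc ∑ η : Fin m → K, ((Finset.univ : Finset ((Fin (m + 1) → K) × (Fin m → K))).filter
          fun νω ↦ planeSection f νω.1 νω.2 η = 0).card
      ≤ ∑ _η : Fin m → K, rationalPointCount f * (f.totalDegree * Fintype.card K ^ (m - 1)) :=
        Finset.sum_le_sum fun η _ ↦ card_filter_planeSection_eq_zero_le hirr (hdeg ▸ hδ2) η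
    _ = Fintype.card K ^ m * (rationalPointCount f * (δ * Fintype.card K ^ (m - 1))) := by
        rw [Finset.sum_const, Finset.card_univ, smul_eq_mul, Fintype.card_fun, Fintype.card_fin, hdeg]
    _ ≤ Fintype.card K ^ m * (δ * Fintype.card K ^ m * (δ * Fintype.card K ^ (m - 1))) :=
        Nat.mul_le_mul_left _ (Nat.mul_le_mul_right _ hN)
    _ = δ ^ 2 * Fintype.card K ^ (3 * m - 1) := by
        have : m + m + (m - 1) = 3 * m - 1 := by omega
        rw [← this, pow_add, pow_add]
        ring

/-- **The averaging estimate (Cafure–Matera 2006, (21)–(22), parametrised form).** Let `K = 𝔽_q`,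
`f ∈ K[x₀, …, xₘ]` (`m ≥ 1`) absolutely irreducible of total degree `δ` with `2 ≤ δ < q`, `N` its
number of zeros in `K^{m+1}`, and `B` the number of parameters `(ν, ω, η) ∈ K^{m+1} × Kᵐ × Kᵐ` whose
plane section is not absolutely irreducible. Then
`q^{m+2} (qᵐ - 1) |N - qᵐ| ≤ qᵐ (qᵐ - 1) q^{m+1} W + δ² q^{3m+1} + (δ - 1) q B` with
`W = (δ-1)(δ-2)√q + 1 + δ + 4δ³`. [cite: CafureMatera2006, §5.1 (21)–(22)] -/
theorem mul_abs_sub_le (hm : 1 ≤ m) {f : MvPolynomial (Fin (m + 1)) K} (hf : IsAbsIrreducible f)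
    {δ : ℕ} (hδ2 : 2 ≤ δ) (hdeg : f.totalDegree = δ) (hq : δ < Fintype.card K) :
    (Fintype.card K : ℝ) ^ (m + 2) * ((Fintype.card K : ℝ) ^ m - 1) *
        |(rationalPointCount f : ℝ) - (Fintype.card K : ℝ) ^ m| ≤
      (Fintype.card K : ℝ) ^ m * ((Fintype.card K : ℝ) ^ m - 1) * (Fintype.card K : ℝ) ^ (m + 1) *
          (((δ - 1) * (δ - 2) : ℕ) * √(Fintype.card K : ℝ) + 1 + δ + 4 * (δ : ℝ) ^ 3) +
        (δ : ℝ) ^ 2 * (Fintype.card K : ℝ) ^ (3 * m - 1) * (Fintype.card K : ℝ) ^ 2 +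
        ((δ : ℝ) - 1) * Fintype.card K *
          (((Finset.univ : Finset ((Fin (m + 1) → K) × (Fin m → K) × (Fin m → K))).filter
            fun p ↦ ¬ Irreducible (MvPolynomial.map (algebraMap K (AlgebraicClosure K))
              (planeSection f p.1 p.2.1 p.2.2))).card : ℝ) := by
  set q : ℕ := Fintype.card K with hq'
  set P : Finset ((Fin (m + 1) → K) × (Fin m → K) × (Fin m → K)) :=
    Finset.univ.filter fun p ↦ p.2.2 ≠ 0 with hP
  set Np : (Fin (m + 1) → K) × (Fin m → K) × (Fin m → K) → ℝ := fun p ↦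
    (rationalPointCount (planeSection f p.1 p.2.1 p.2.2) : ℝ) with hNp
  set W : ℝ := ((δ - 1) * (δ - 2) : ℕ) * √(q : ℝ) + 1 + δ + 4 * (δ : ℝ) ^ 3 with hW
  have hirrK : Irreducible f := irreducible_of_irreducible_map (algebraMap K (AlgebraicClosure K)) hf
  -- the averaging identity: `∑_p (N_p - q) = q^{m+2} (q^m - 1) (N - q^m)`
  have hsumN : ∑ p ∈ P, Np p = (q : ℝ) ^ m * ((q : ℝ) ^ m - 1) * ((q : ℝ) ^ 2 * rationalPointCount f) := by
    rw [hNp, hP, ← sum_filter_rationalPointCount_planeSection f]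
    push_cast
    rfl
  have hcardP : (P.card : ℝ) = (q : ℝ) ^ m * ((q : ℝ) ^ m - 1) * (q : ℝ) ^ (m + 1) := card_filter_ne_zero
  have hident : ∑ p ∈ P, (Np p - q) =
      (q : ℝ) ^ (m + 2) * ((q : ℝ) ^ m - 1) * ((rationalPointCount f : ℝ) - (q : ℝ) ^ m) := by
    rw [Finset.sum_sub_distrib, hsumN, Finset.sum_const, nsmul_eq_mul, hcardP]
    ring
  -- the per-parameter bound, summed
  have hper : ∀ p ∈ P, |Np p - q| ≤ W +
      (if planeSection f p.1 p.2.1 p.2.2 = 0 then (q : ℝ) ^ 2 else 0) +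
      (if ¬ Irreducible (MvPolynomial.map (algebraMap K (AlgebraicClosure K))
        (planeSection f p.1 p.2.1 p.2.2)) then ((δ : ℝ) - 1) * q else 0) :=
    fun p _ ↦ abs_sub_le_planeSection hδ2 hdeg hq p.1 p.2.1 p.2.2
  have hsum_le : ∑ p ∈ P, |Np p - q| ≤ P.card * W +
      (q : ℝ) ^ 2 * ((Finset.univ : Finset ((Fin (m + 1) → K) × (Fin m → K) × (Fin m → K))).filter
        fun p ↦ planeSection f p.1 p.2.1 p.2.2 = 0).card +
      ((δ : ℝ) - 1) * q * ((Finset.univ : Finset ((Fin (m + 1) → K) × (Fin m → K) × (Fin m → K))).filter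
        fun p ↦ ¬ Irreducible (MvPolynomial.map (algebraMap K (AlgebraicClosure K))
          (planeSection f p.1 p.2.1 p.2.2))).card := by
    refine (Finset.sum_le_sum hper).trans ?_
    rw [Finset.sum_add_distrib, Finset.sum_add_distrib, Finset.sum_const, nsmul_eq_mul]
    refine add_le_add (add_le_add le_rfl ?_) ?_
    · rw [← Finset.sum_filter, Finset.sum_const, nsmul_eq_mul, mul_comm]
      refine mul_le_mul_of_nonneg_left ?_ (by positivity)
      exact_mod_cast Finset.card_le_card (Finset.filter_subset_filter _ (Finset.filter_subset _ _))
    · rw [← Finset.sum_filter, Finset.sum_const, nsmul_eq_mul, mul_comm]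
      refine mul_le_mul_of_nonneg_left ?_ ?_
      · exact_mod_cast Finset.card_le_card (Finset.filter_subset_filter _ (Finset.filter_subset _ _))
      · have : (1 : ℝ) ≤ δ := by exact_mod_cast (show 1 ≤ δ by omega)
        have : (0 : ℝ) ≤ q := Nat.cast_nonneg _
        nlinarith
  -- the vanishing sections
  have hZ : (((Finset.univ : Finset ((Fin (m + 1) → K) × (Fin m → K) × (Fin m → K))).filter
      fun p ↦ planeSection f p.1 p.2.1 p.2.2 = 0).card : ℝ) ≤ (δ : ℝ) ^ 2 * (q : ℝ) ^ (3 * m - 1) := by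
    exact_mod_cast card_filter_planeSection_eq_zero_le' hm hirrK hδ2 hdeg
  -- conclusion
  rw [← abs_of_nonneg (show (0 : ℝ) ≤ (q : ℝ) ^ (m + 2) * ((q : ℝ) ^ m - 1) by
    have h1 : (1 : ℝ) ≤ (q : ℝ) ^ m := one_le_pow₀ (by exact_mod_cast Fintype.card_pos)
    have : (0 : ℝ) ≤ (q : ℝ) ^ (m + 2) := by positivity
    nlinarith), ← abs_mul, ← hident]
  refine (Finset.abs_sum_le_sum_abs _ _).trans (hsum_le.trans ?_)
  rw [hcardP]
  have hq2 : (0 : ℝ) ≤ (q : ℝ) ^ 2 := by positivity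
  nlinarith [mul_le_mul_of_nonneg_left hZ hq2]

end Sum

end Literature.NumberTheory.DiophantineGeometry

end
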